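import Summits.MatrixMultiplication.OmegaCensus.STPPVosperTightStructure

/-!
# ω-census (abelian STPP census): the DUAL form of the N18 chain — two small critical pairs and a three-way partition (kernel)

HONEST FRAMING (pub-omega census; verbatim): lottery ticket; floor = certified bounds/negative ranges.
Census STRUCTURE (seat pub-omega-stpp-1 gen 32, 2026-08-28), family (b2).  A reformulation of the N18 chain (`STPPVosperTightStructure.lean`) that is
symmetric in the two Vosper steps and keeps BOTH sumsets small — the shape needed for SLACK ≥ 2 laws (HOME `pub-omega-stpp-1-g32/SLACK2-DESIGN.md`).
`C`-reading of block `i` of an STPP family in a finite abelian group `H` (all sets non-empty): `W = {c − a − b}` (`|W| = aᵢbᵢcᵢ`), `SY = (−Aᵢ) + Y°`,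
`T = (−Bᵢ) + Z°` with `Y° = ⋃_{k≠i}(C_k − B_k)`, `Z° = ⋃_{k≠i}(C_k − A_k)`.

* `disjoint_negB_add_DU_AC` : `T` is disjoint from `V = W ∪ SY` (dual of `Bᵢ + V ⊆ H ∖ Z°`: `−b + ζ = v` would put `b + v = ζ ∈ Z°`);
* `card_W_add_card_SY_add_card_T_le` : `|W| + |SY| + |T| ≤ |H|` — the three sets are pairwise disjoint;
* `slack_two_cases` (prime order): if the pattern has N18-slack `s` at block `i` (`z + b + vol + a + L + s = p + 2`) then, with `δ₁ = |SY| − (a + L − 1)` and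
  `δ₂′ = |T| − (b + z − 1)` (both `≥ 0` by Cauchy–Davenport), `δ₁ + δ₂′ ≤ s`; so BOTH `(−Aᵢ, Y°)` and `(−Bᵢ, Z°)` are small-sumset pairs (Vosper / Hamidoune–Rødseth /
  two-above), and when `δ₁ + δ₂′ = s` the three sets PARTITION `H` (`eq_univ_of_card`).
UNCONDITIONAL.  Nothing here is progress on `ω`.

References: A. G. Vosper, J. London Math. Soc. 31 (1956); H. Cohn, R. Kleinberg, B. Szegedy, C. Umans, FOCS 2005 (arXiv:math/0511460), Def. 5.1.
-/

open Finset
open scoped Pointwise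

namespace Summit.MatrixMultiplication.OmegaCensus.CubeNB

open Literature.Computability.AlgebraicComplexity
open Literature.Combinatorics.Additive
open Summit.MatrixMultiplication.OmegaCensus.STPPKneser

section General

variable {H : Type*} [AddCommGroup H] [DecidableEq H] [Fintype H] {N : ℕ} {A B C : Fin N → Finset H}

/-- **Dual inclusion.**  `T = (−Bᵢ) + Z°` is disjoint from `V = W ∪ ((−Aᵢ) + Y°)`: an equation `−b + ζ = v` would give `b + v = ζ ∈ Z°`, contradicting
`Bᵢ + V ⊆ H ∖ Z°` (`B_add_W_union_negA_add_subset`). [cite: CohnKleinbergSzegedyUmans2005, Def. 5.1] -/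
theorem disjoint_negB_add_DU_AC (hS : IsSTPP A B C) (i : Fin N) :
    Disjoint ((B i).image (fun b => (0 : H) - b) + DU A C (univ.erase i))
      ((((A i) ×ˢ ((B i) ×ˢ (C i))).image fun q : H × H × H => (0 : H) + q.2.2 - q.1 - q.2.1) ∪
        ((A i).image (fun a => (0 : H) - a) + DU B C (univ.erase i))) := by
  rw [Finset.disjoint_left]
  intro t ht hv
  obtain ⟨x, hx, ζ, hζ, rfl⟩ := Finset.mem_add.1 ht
  obtain ⟨b, hb, rfl⟩ := Finset.mem_image.1 hx
  have hmem : b + (0 - b + ζ) ∈ B i + ((((A i) ×ˢ ((B i) ×ˢ (C i))).image fun q : H × H × H => (0 : H) + q.2.2 - q.1 - q.2.1) ∪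
      ((A i).image (fun a => (0 : H) - a) + DU B C (univ.erase i))) := Finset.add_mem_add hb hv
  have h := B_add_W_union_negA_add_subset hS i hmem
  rw [Finset.mem_sdiff] at h
  exact h.2 (by rw [show b + (0 - b + ζ) = ζ by abel]; exact hζ)

/-- **The three-set bound.**  `|W| + |(−Aᵢ) + Y°| + |(−Bᵢ) + Z°| ≤ |H|`. [cite: CohnKleinbergSzegedyUmans2005, Def. 5.1] -/
theorem card_W_add_card_SY_add_card_T_le (hS : IsSTPP A B C) (i : Fin N) :
    #(((A i) ×ˢ ((B i) ×ˢ (C i))).image fun q : H × H × H => (0 : H) + q.2.2 - q.1 - q.2.1) +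
      #((A i).image (fun a => (0 : H) - a) + DU B C (univ.erase i)) + #((B i).image (fun b => (0 : H) - b) + DU A C (univ.erase i)) ≤
      Fintype.card H := by
  have h1 := Finset.card_union_of_disjoint (disjoint_W_negA_add_DU hS i)
  have h2 := Finset.card_union_of_disjoint ((disjoint_negB_add_DU_AC hS i).symm)
  rw [h1] at h2
  rw [← h2]
  exact Finset.card_le_univ _

/-- When the bound is attained the three sets partition `H`: their union is `univ`. [folklore] -/
theorem union_eq_univ_of_card (hS : IsSTPP A B C) (i : Fin N)
    (h : #(((A i) ×ˢ ((B i) ×ˢ (C i))).image fun q : H × H × H => (0 : H) + q.2.2 - q.1 - q.2.1) +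
      #((A i).image (fun a => (0 : H) - a) + DU B C (univ.erase i)) + #((B i).image (fun b => (0 : H) - b) + DU A C (univ.erase i)) =
      Fintype.card H) :
    (((A i) ×ˢ ((B i) ×ˢ (C i))).image fun q : H × H × H => (0 : H) + q.2.2 - q.1 - q.2.1) ∪
        ((A i).image (fun a => (0 : H) - a) + DU B C (univ.erase i)) ∪ ((B i).image (fun b => (0 : H) - b) + DU A C (univ.erase i)) = univ := by
  have h1 := Finset.card_union_of_disjoint (disjoint_W_negA_add_DU hS i)
  have h2 := Finset.card_union_of_disjoint ((disjoint_negB_add_DU_AC hS i).symm)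
  rw [h1] at h2
  exact Finset.eq_univ_of_card _ (by rw [h2, h])

end General

section Prime

variable {p : ℕ} [hp : Fact p.Prime] {N : ℕ} {A B C : Fin N → Finset (ZMod p)}

/-- **Slack bookkeeping at prime order.**  With `a = |Aᵢ|`, `b = |Bᵢ|`, `vol = aᵢbᵢcᵢ`, `z = Σ_{k≠i} a_k c_k`, `L = Σ_{k≠i} b_k c_k` and slack `s`
(`z + b + vol + a + L + s = p + 2`, `a, b ≥ 1`): the excesses `δ₁ = |(−Aᵢ)+Y°| − (a+L−1)` and `δ₂′ = |(−Bᵢ)+Z°| − (b+z−1)` over Cauchy–Davenport satisfy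
`|(−Aᵢ)+Y°| + |(−Bᵢ)+Z°| ≤ (a + L − 1) + (b + z − 1) + s` (so `δ₁ + δ₂′ ≤ s`). [cite: CohnKleinbergSzegedyUmans2005, Def. 5.1] -/
theorem card_SY_add_card_T_le_of_slack (hS : IsSTPP A B C) (i : Fin N) {a b vol z L s : ℕ}
    (hvol : #(A i) * #(B i) * #(C i) = vol)
    (hz : ∑ k ∈ univ.erase i, #(A k) * #(C k) = z) (hL : ∑ k ∈ univ.erase i, #(B k) * #(C k) = L)
    (hslack : z + b + vol + a + L + s = p + 2) (h1a : 1 ≤ a) (h1b : 1 ≤ b) :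
    #((A i).image (fun x => (0 : ZMod p) - x) + DU B C (univ.erase i)) + #((B i).image (fun x => (0 : ZMod p) - x) + DU A C (univ.erase i)) ≤
      (a + L - 1) + (b + z - 1) + s := by
  have h := card_W_add_card_SY_add_card_T_le hS i
  rw [card_image_blockSum hS i 0, hvol, ZMod.card] at h
  omega

end Prime

end Summit.MatrixMultiplication.OmegaCensus.CubeNB
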